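import Literature.Computability.Complexity.CountingReductions
import Mathlib.Data.List.Flatten
import Mathlib.Data.Fintype.Pi
import HarnessLib

/-!
# The cells of a formula: literal occurrences and consistent state vectors

Combinatorial bookkeeping for the `#SAT → #HamPath` construction, with no graphs yet. The **cells**
of a CNF `φ` over `ℕ` are its literal occurrences `φ.flatten`, numbered `0, …, N-1` clause by clause
(`FormulaCells.cells`, `FormulaCells.start j` = the number of the first cell of clause `j`). A
**state vector** assigns a Boolean to every cell (the value the construction gives to the cell's
VARIABLE); it is **uniform** if cells of the same variable carry the same value, and **good** if
moreover `φ` is true under the assignment it induces (`FormulaCells.Good`). Main results: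

* `FormulaCells.card_good_eq_numSat` — **the good state vectors are in bijection with the satisfying
  assignments**: `#{σ good} = #SAT(φ)`;
* `FormulaCells.uniform_iff_forall_next` — uniformity is the conjunction of the equalities
  `σ c = σ (next c)` between consecutive occurrences of a variable (what the XOR-gadgets enforce);
* `FormulaCells.good_iff` — goodness read cell-wise: uniform, and every clause has a cell whose state
  is the polarity of its literal (what the OR-gadgets enforce).

## References

* M. Liśkiewicz, M. Ogihara, S. Toda, TCS 304 (2003) 129–156, §3 (the correspondence between
  Hamiltonian paths and truth assignments).
-/

namespace Literature.Combinatorics.SimpleGraph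

open Literature.Computability.Complexity

open scoped Classical

namespace FormulaCells

variable (φ : CNF ℕ)

/-! ### Cells -/

/-- **The cells**: the literal occurrences, clause by clause. [folklore] -/
def cells : List (Literal ℕ) :=
  φ.flatten

/-- The number of cells. [folklore] -/
def N : ℕ :=
  (cells φ).length

/-- The variable of cell `c`. [folklore] -/
def varOf (c : ℕ) : ℕ :=
  ((cells φ).getD c (0, false)).1

/-- The polarity of the literal of cell `c`. [folklore] -/
def polOf (c : ℕ) : Bool :=
  ((cells φ).getD c (0, false)).2

/-- The first cell of clause `j`. [folklore] -/
def start (j : ℕ) : ℕ :=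
  ((φ.take j).flatten).length

/-- The variable of a cell, as an entry of the cell list. [folklore] -/
theorem varOf_eq {c : ℕ} (hc : c < N φ) : varOf φ c = ((cells φ)[c]'hc).1 := by
  rw [varOf, List.getD_eq_getElem _ _ hc]

/-- The polarity of a cell, as an entry of the cell list. [folklore] -/
theorem polOf_eq {c : ℕ} (hc : c < N φ) : polOf φ c = ((cells φ)[c]'hc).2 := by
  rw [polOf, List.getD_eq_getElem _ _ hc]

/-- The variables of the cells are the variables of the formula. [folklore] -/
theorem varOf_mem_vars {c : ℕ} (hc : c < N φ) : varOf φ c ∈ φ.vars := by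
  rw [varOf_eq φ hc, CNF.vars, List.mem_toFinset, List.mem_map]
  exact ⟨_, List.getElem_mem hc, rfl⟩

/-- Every variable of the formula is the variable of a cell. [folklore] -/
theorem exists_cell_of_mem_vars {x : ℕ} (hx : x ∈ φ.vars) : ∃ c, ∃ _ : c < N φ, varOf φ c = x := by
  rw [CNF.vars, List.mem_toFinset, List.mem_map] at hx
  obtain ⟨l, hl, rfl⟩ := hx
  obtain ⟨c, hc, rfl⟩ := List.mem_iff_getElem.1 hl
  exact ⟨c, hc, (varOf_eq φ hc)⟩

/-- **The cells of clause `j` are `start j, …, start j + |C_j| - 1`, and carry its literals.**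
[folklore] -/
theorem cells_decomp {j : ℕ} (hj : j < φ.length) :
    cells φ = (φ.take j).flatten ++ (φ[j] ++ (φ.drop (j + 1)).flatten) := by
  conv_lhs => rw [cells, ← List.take_append_drop j φ, List.drop_eq_getElem_cons hj]
  rw [List.flatten_append, List.flatten_cons]

/-- The cells of clause `j` are cells. [folklore] -/
theorem start_add_lt {j : ℕ} (hj : j < φ.length) {i : ℕ} (hi : i < φ[j].length) : start φ j + i < N φ := by
  have := congrArg List.length (cells_decomp φ hj)
  simp only [List.length_append] at this
  rw [N, this, start]
  omega

/-- Cell `start j + i` carries the `i`-th literal of clause `j`. [folklore] -/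
theorem getElem_cells_start {j : ℕ} (hj : j < φ.length) {i : ℕ} (hi : i < φ[j].length) :
    (cells φ)[start φ j + i]'(start_add_lt φ hj hi) = φ[j][i] := by
  have hdec := cells_decomp φ hj
  rw [List.getElem_of_eq hdec, List.getElem_append_right (by rw [start]; omega)]
  rw [List.getElem_append_left (by rw [start]; simpa using hi)]
  congr 1
  rw [start]; omega

/-- Every cell lies in some clause. [folklore] -/
theorem exists_clause_of_lt {c : ℕ} (hc : c < N φ) : ∃ j, ∃ hj : j < φ.length, ∃ i, ∃ _ : i < φ[j].length, c = start φ j + i := by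
  induction φ generalizing c with
  | nil => simp [N, cells] at hc
  | cons C rest ih =>
    by_cases h : c < C.length
    · exact ⟨0, by simp, c, by simpa using h, by simp [start]⟩
    · have hc' : c - C.length < N rest := by
        simp only [N, cells, List.flatten_cons, List.length_append] at hc ⊢
        omega
      obtain ⟨j, hj, i, hi, heq⟩ := ih hc'
      refine ⟨j + 1, by simpa using hj, i, by simpa using hi, ?_⟩
      simp only [start, List.take_succ_cons, List.flatten_cons, List.length_append] at heq ⊢
      omega

/-! ### State vectors -/

/-- A state vector is **uniform**: cells of the same variable carry the same value. [folklore] -/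
def Uniform (σ : Fin (N φ) → Bool) : Prop :=
  ∀ c c' : Fin (N φ), varOf φ c = varOf φ c' → σ c = σ c'

/-- The value of a variable read off a state vector: the value of its first cell (`false` for
variables without cells). [folklore] -/
noncomputable def readVar (σ : Fin (N φ) → Bool) (x : ℕ) : Bool :=
  if h : ∃ c, c < N φ ∧ varOf φ c = x then σ ⟨Nat.find h, (Nat.find_spec h).1⟩ else false

/-- The assignment of the variables of `φ` induced by a state vector. [folklore] -/
noncomputable def toAssign (σ : Fin (N φ) → Bool) : φ.vars → Bool :=
  fun x => readVar φ σ x.1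

/-- The state vector of an assignment: every cell carries the value of its variable. [folklore] -/
def toState (a : φ.vars → Bool) : Fin (N φ) → Bool :=
  fun c => a ⟨varOf φ c, varOf_mem_vars φ c.isLt⟩

/-- The state vector of an assignment is uniform. [folklore] -/
theorem uniform_toState (a : φ.vars → Bool) : Uniform φ (toState φ a) := by
  intro c c' h
  simp only [toState]
  congr 1
  exact Subtype.ext h

/-- Reading a variable off a state vector reads one of its cells. [folklore] -/
theorem readVar_eq {σ : Fin (N φ) → Bool} (hσ : Uniform φ σ) (c : Fin (N φ)) : readVar φ σ (varOf φ c) = σ c := by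
  have h : ∃ c', c' < N φ ∧ varOf φ c' = varOf φ c := ⟨c, c.isLt, rfl⟩
  rw [readVar, dif_pos h]
  exact hσ _ _ (Nat.find_spec h).2

/-- Assignment ↦ state vector ↦ assignment is the identity. [folklore] -/
theorem toAssign_toState (a : φ.vars → Bool) : toAssign φ (toState φ a) = a := by
  funext ⟨x, hx⟩
  obtain ⟨c, hc, rfl⟩ := exists_cell_of_mem_vars φ hx
  simp only [toAssign]
  rw [readVar_eq φ (uniform_toState φ a) ⟨c, hc⟩]
  rfl

/-- State vector ↦ assignment ↦ state vector is the identity on uniform state vectors. [folklore] -/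
theorem toState_toAssign {σ : Fin (N φ) → Bool} (hσ : Uniform φ σ) : toState φ (toAssign φ σ) = σ := by
  funext c
  simp only [toState, toAssign]
  exact readVar_eq φ hσ c

/-- **A good state vector**: uniform, and `φ` true under the induced assignment. [folklore] -/
def Good (σ : Fin (N φ) → Bool) : Prop :=
  Uniform φ σ ∧ φ.eval (φ.extendAssignment (toAssign φ σ)) = true

/-- **The good state vectors are as many as the satisfying assignments: `#{σ good} = #SAT(φ)`.**
[cite: LiskiewiczOgiharaToda2003, §3 ("each Hamiltonian path … corresponds to a satisfying assignment")] -/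
theorem card_good_eq_numSat :
    (Finset.univ.filter fun σ : Fin (N φ) → Bool => Good φ σ).card = φ.numSat := by
  classical
  rw [CNF.numSat]
  refine Finset.card_bij (fun σ _ => toAssign φ σ) (fun σ hσ => ?_) (fun σ hσ σ' hσ' h => ?_) (fun a ha => ?_)
  · simp only [Finset.mem_filter, Finset.mem_univ, true_and] at hσ ⊢
    exact hσ.2
  · simp only [Finset.mem_filter, Finset.mem_univ, true_and] at hσ hσ'
    rw [← toState_toAssign φ hσ.1, ← toState_toAssign φ hσ'.1, h]
  · simp only [Finset.mem_filter, Finset.mem_univ, true_and] at ha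
    refine ⟨toState φ a, ?_, toAssign_toState φ a⟩
    simp only [Finset.mem_filter, Finset.mem_univ, true_and, Good]
    rw [toAssign_toState]
    exact ⟨uniform_toState φ a, ha⟩

/-! ### Goodness read off the cells -/

/-- The value of the literal of a cell under the induced assignment of a uniform state vector: the
literal is true iff the state of the cell is its polarity. [folklore] -/
theorem eval_extendAssignment_cell {σ : Fin (N φ) → Bool} (hσ : Uniform φ σ) (c : Fin (N φ)) :
    Literal.eval (φ.extendAssignment (toAssign φ σ)) ((cells φ)[c.val]'c.isLt) = (σ c == polOf φ c) := by
  have hx : varOf φ c ∈ φ.vars := varOf_mem_vars φ c.isLt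
  rw [Literal.eval, ← varOf_eq φ c.isLt, ← polOf_eq φ c.isLt, CNF.extendAssignment, dif_pos hx]
  simp only [toAssign]
  rw [readVar_eq φ hσ c]

/-- **Goodness cell-wise**: uniform, and every clause has a cell whose state is the polarity of its
literal. [folklore] -/
theorem good_iff (σ : Fin (N φ) → Bool) :
    Good φ σ ↔ Uniform φ σ ∧ ∀ j (hj : j < φ.length), ∃ i, ∃ hi : i < φ[j].length,
      σ ⟨start φ j + i, start_add_lt φ hj hi⟩ = polOf φ (start φ j + i) := by
  unfold Good
  refine and_congr_right fun hσ => ?_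
  rw [CNF.eval_eq_true_iff]
  constructor
  · intro h j hj
    have := h _ (List.getElem_mem hj)
    rw [Clause.eval, List.any_eq_true] at this
    obtain ⟨l, hl, hev⟩ := this
    obtain ⟨i, hi, rfl⟩ := List.mem_iff_getElem.1 hl
    refine ⟨i, hi, ?_⟩
    have key := eval_extendAssignment_cell φ hσ ⟨start φ j + i, start_add_lt φ hj hi⟩
    simp only [getElem_cells_start φ hj hi] at key
    rw [key] at hev
    simpa using hev
  · intro h C hC
    obtain ⟨j, hj, rfl⟩ := List.mem_iff_getElem.1 hC
    obtain ⟨i, hi, hst⟩ := h j hj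
    rw [Clause.eval, List.any_eq_true]
    refine ⟨φ[j][i], List.getElem_mem hi, ?_⟩
    have key := eval_extendAssignment_cell φ hσ ⟨start φ j + i, start_add_lt φ hj hi⟩
    simp only [getElem_cells_start φ hj hi] at key
    rw [key]
    simpa using hst

/-! ### Uniformity as consecutive-occurrence equalities -/

/-- **The next occurrence** of the variable of cell `c` after `c`, if any. [folklore] -/
noncomputable def next? (c : ℕ) : Option ℕ :=
  if h : ∃ c', c < c' ∧ c' < N φ ∧ varOf φ c' = varOf φ c then some (Nat.find h) else none

/-- The next occurrence is a later cell of the same variable, with no such cell in between. [folklore] -/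
theorem next?_spec {c c' : ℕ} (h : next? φ c = some c') :
    c < c' ∧ c' < N φ ∧ varOf φ c' = varOf φ c ∧ ∀ d, c < d → d < c' → varOf φ d ≠ varOf φ c := by
  unfold next? at h
  split_ifs at h with hex
  simp only [Option.some.injEq] at h
  subst h
  obtain ⟨h1, h2, h3⟩ := Nat.find_spec hex
  refine ⟨h1, h2, h3, fun d hd hd' heq => ?_⟩
  exact Nat.find_min hex hd' ⟨hd, lt_trans hd' h2, heq⟩

/-- A later cell of the same variable is at or after the next occurrence. [folklore] -/
theorem next?_eq_some_of {c c' : ℕ} (hcc' : c < c') (hc' : c' < N φ) (hv : varOf φ c' = varOf φ c) :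
    ∃ c₁, next? φ c = some c₁ ∧ c₁ ≤ c' := by
  have hex : ∃ c', c < c' ∧ c' < N φ ∧ varOf φ c' = varOf φ c := ⟨c', hcc', hc', hv⟩
  refine ⟨Nat.find hex, ?_, Nat.find_min' hex ⟨hcc', hc', hv⟩⟩
  unfold next?
  rw [dif_pos hex]

/-- **Uniformity is the conjunction of the equalities between consecutive occurrences.**
[folklore] -/
theorem uniform_iff_forall_next (σ : Fin (N φ) → Bool) :
    Uniform φ σ ↔ ∀ (c c' : Fin (N φ)), next? φ c = some c'.val → σ c = σ c' := by
  constructor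
  · intro hσ c c' h
    exact hσ c c' (next?_spec φ h).2.2.1.symm
  · intro h
    -- equal variables at distance `d` have equal states, by induction on `d`
    suffices key : ∀ d (c c' : Fin (N φ)), c'.val = c.val + d → varOf φ c = varOf φ c' → σ c = σ c' by
      intro c c' hv
      rcases Nat.lt_trichotomy c.val c'.val with hlt | heq | hgt
      · exact key (c'.val - c.val) c c' (by omega) hv
      · rw [Fin.ext heq]
      · exact (key (c.val - c'.val) c' c (by omega) hv.symm).symm
    intro d
    induction d using Nat.strong_induction_on with
    | _ d ih =>
      intro c c' hd hv
      rcases Nat.eq_zero_or_pos d with rfl | hd0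
      · rw [Fin.ext (by omega : c.val = c'.val)]
      · obtain ⟨c₁, hc₁, hle⟩ := next?_eq_some_of φ (c := c.val) (c' := c'.val) (by omega) c'.isLt hv.symm
        obtain ⟨h1, h2, h3, -⟩ := next?_spec φ hc₁
        have hstep : σ c = σ ⟨c₁, h2⟩ := h c ⟨c₁, h2⟩ hc₁
        rw [hstep]
        rcases Nat.lt_or_ge c₁ c'.val with hlt | hge
        · have hgap : c'.val - c₁ < d := by omega
          have hsum : c'.val = (⟨c₁, h2⟩ : Fin (N φ)).val + (c'.val - c₁) := by
            show c'.val = c₁ + (c'.val - c₁); omega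
          exact ih (c'.val - c₁) hgap ⟨c₁, h2⟩ c' hsum (h3.trans hv)
        · have : (⟨c₁, h2⟩ : Fin (N φ)) = c' := Fin.ext (by show c₁ = c'.val; omega)
          rw [this]

end FormulaCells

end Literature.Combinatorics.SimpleGraph
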